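import Summits.AtomisticToContinuum.Crystallization.Theorems.OverbindingBudgetElasticSplitPricing

/-!
# OverbindingBudget — «ElasticSplit», scale layer: the T₀-slivers of the typed features and the cut of RELAX BY THE CLEAN SCALE (decomp-a2c lens-4, generation 27; critic row 375 (3)(α)(β))

Helper file (`--supports stmt-AtomisticToContinuum-31280`).

§1 **Slivers** (critic row 375 (1)(i), typed here): `CleanClass T₀ D` fixes ONE global clean scale `a ∈ [47/50, 1]` (`RT a T₀` at every
site: bonds in `[49/50·a − T₀, 51/50·a + T₀]`, then a gap up to `63/50·a − T₀`), while the typed features of a `(t, L)`-strained texture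
(g26, `…EdgeRelaxationStatements.LongAt` …) are stated scale-free; so each feature pins the scale to a SLIVER:
`ShortAt ⇒ 49/50·a − T₀ < 2303/2500 − t` (`a < 0.94409 − t/0.98` at `T₀ = 1/250`; all bonds `≤ 0.9670`), `LowGapAt ⇒ 63/50·a − T₀ < 2961/2500 − t`
(`a < 0.94318`), `LongAt ⇒ 51/50 + t < 51/50·a + T₀` (`a > 0.99607`, all bonds `≥ 0.9721`), `ContrastAt ⇒ t < T₀`, `GapClashAt ⇒ t < T₀`.
§2 **The cut by scale** at the threshold `189/200`: `HasCompressedScale T₀ Y` (a clean scale `≤ 189/200`) versus its negation.  In the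
UNCOMPRESSED class (`T₀ ≤ 1/250`) SHORT and LOWGAP features are impossible (`not_shortAt_of_uncompressed`, `not_lowGapAt_of_uncompressed`), so a
strained uncompressed texture is strained of the ELASTIC types LONG / CONTRAST / GAPCLASH only (`elastic_types_of_uncompressed`).  Pieces:
* `CompressedVirialLaw T₀ D` — the EQUATION-OF-STATE branch in VIRIAL currency (strain-free): a texture of the recurrent clean class with a
  compressed clean scale has DILATION-strained cubes (`(S₁₂ − S₆)²/(24 S₁₂) ≥ κ ℓ³`: positive mean pressure).  By the dilation test (PROVED,
  `…ElasticSplitDilation`) it implies `CompressedRelax` (RELAX restricted to the compressed class).  Numbers (fcc/hcp, tree units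
  `V = r⁻¹²/12 − r⁻⁶/6`, `a⋆ = 0.97123`): per-site virial `s₁₂ − s₆ = +0.47` at the least compressed admissible shell `0.967` (first shell `+3.27`,
  tail `−2.80`: an adversarial clean texture needs `16 %` more tail attraction at fixed first shell), `+3.80` at `0.944` (tail would need `×2.1`).
* `BalancedLiouvilleLaw T₀ D` — the ELASTIC branch: `ElasticLiouvilleLaw` restricted to uncompressed textures (window near `a⋆`; sparse charge,
  locally optimal, virial-balanced, strained ⇒ strained cubes); conjecturally vacuous (discrete nonlinear elastic Liouville).
Glue (all PROVED): `EdgeRelaxationLaw ⟸ CompressedRelax ∧ UncompressedRelax`; `CompressedRelax ⟸ CompressedVirialLaw`;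
`UncompressedRelax ⟸ ChargeDensityRelax ∧ LocalRelaxationTest ∧ BalancedLiouvilleLaw`; `ElasticLiouvilleLaw ⟸ CompressedVirialLaw ∧ BalancedLiouvilleLaw`;
cone `rdef_of_grossU_scaleSplit_record : GrossCleanBallsU (1/250) 10 → ChargedEnergyGap → LocalRelaxationTest (1/250) 10 → CompressedVirialLaw (1/250) 10 →
BalancedLiouvilleLaw (1/250) 10 → CleanlessExcessT → CoherentResidual 10 → RobustDefectLimitWindows`.
-/

namespace Summit.AtomisticToContinuum.Crystallization.Theorems.OverbindingBudgetElasticSplitScale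

open Filter Metric Set Topology
open scoped BigOperators
open Literature.MathematicalPhysics.StatisticalMechanics
open Summit.AtomisticToContinuum.Crystallization.Theses.OverbindingBudget (RobustDefectLimitWindows)
open Summit.AtomisticToContinuum.Crystallization.Theses.PricedLinkCensus (ChargedEnergyGap)
open Summit.AtomisticToContinuum.Crystallization.Theorems.OverbindingBudgetViolatorDensityFloor (RT)
open Summit.AtomisticToContinuum.Crystallization.Theorems.OverbindingBudgetGradedBareness (CleanlessExcessT)
open Summit.AtomisticToContinuum.Crystallization.Theorems.OverbindingBudgetCoherentCut (CoherentResidual)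
open Summit.AtomisticToContinuum.Crystallization.Theorems.OverbindingBudgetRecurrentDustStatements (ViolatorsL)
open Summit.AtomisticToContinuum.Crystallization.Theorems.OverbindingBudgetUniformCutStatements (GrossCleanBallsU)
open Summit.AtomisticToContinuum.Crystallization.Theorems.OverbindingBudgetEdgeRelaxationStatements
  (StrainedCubes CleanClass EdgeRelaxationLaw LongAt ShortAt LowGapAt ContrastAt GapClashAt)
open Summit.AtomisticToContinuum.Crystallization.Theorems.OverbindingBudgetEdgeRelaxationTyping (types_of_violators)
open Summit.AtomisticToContinuum.Crystallization.Theorems.OverbindingBudgetElasticSplitStatements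
open Summit.AtomisticToContinuum.Crystallization.Theorems.OverbindingBudgetElasticSplitDilation
  (strainedCubes_of_dilationStrained rdef_of_grossU_split_coherent)
open Summit.AtomisticToContinuum.Crystallization.Theorems.OverbindingBudgetElasticSplitPricing (chargeDensityRelax_of_chargedEnergyGap)

/-! ## §1  The slivers: each typed feature pins the clean scale -/

/-- SHORT pins the scale from above: `49/50·a − T₀ < 2303/2500 − t`. [this file] -/
theorem scale_lt_of_shortAt {a T₀ t L : ℝ} {Y : Set (EuclideanSpace ℝ (Fin 3))} {q : EuclideanSpace ℝ (Fin 3)}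
    (hclean : ∀ y ∈ Y, RT a T₀ Y y) (h : ShortAt t L Y q) : a * (1 - 1 / 50) - T₀ < 2303 / 2500 - t := by
  obtain ⟨y, hy, w, hw, -, hne, hd⟩ := h
  obtain ⟨-, -, h3⟩ := hclean y hy
  obtain ⟨hlow, -⟩ := h3 w hw hne
  linarith

/-- LOWGAP pins the scale from above: `63/50·a − T₀ < 2961/2500 − t` (`a ≤ 1`, `T₀ ≤ 1/20`). [this file] -/
theorem scale_lt_of_lowGapAt {a T₀ t L : ℝ} {Y : Set (EuclideanSpace ℝ (Fin 3))} {q : EuclideanSpace ℝ (Fin 3)} (ha1 : a ≤ 1)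
    (hT₀ : T₀ ≤ 1 / 20) (hclean : ∀ y ∈ Y, RT a T₀ Y y) (h : LowGapAt t L Y q) : a * (63 / 50) - T₀ < 2961 / 2500 - t := by
  obtain ⟨y, hy, w, hw, -, hd1, hd2⟩ := h
  have hne : w ≠ y := by
    intro hwy
    rw [hwy, dist_self] at hd1
    linarith
  obtain ⟨-, -, h3⟩ := hclean y hy
  obtain ⟨-, h | h⟩ := h3 w hw hne
  · linarith
  · linarith

/-- LONG pins the scale from below: `51/50 + t < 51/50·a + T₀` (`47/50 ≤ a`, `T₀ ≤ 1/20`). [this file] -/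
theorem scale_gt_of_longAt {a T₀ t L : ℝ} {Y : Set (EuclideanSpace ℝ (Fin 3))} {q : EuclideanSpace ℝ (Fin 3)} (ha : 47 / 50 ≤ a)
    (hT₀ : T₀ ≤ 1 / 20) (hclean : ∀ y ∈ Y, RT a T₀ Y y) (h : LongAt t L Y q) : 51 / 50 + t < a * (1 + 1 / 50) + T₀ := by
  obtain ⟨y, hy, w, hw, -, hne, hd1, hd2⟩ := h
  obtain ⟨-, -, h3⟩ := hclean y hy
  obtain ⟨-, h | h⟩ := h3 w hw hne
  · linarith
  · linarith

/-- CONTRAST needs margin below the tolerance: `t < T₀` (`47/50 ≤ a ≤ 1`, `T₀ ≤ 1/20`). [this file] -/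
theorem margin_lt_of_contrastAt {a T₀ t L : ℝ} {Y : Set (EuclideanSpace ℝ (Fin 3))} {q : EuclideanSpace ℝ (Fin 3)} (ha : 47 / 50 ≤ a)
    (hT₀ : T₀ ≤ 1 / 20) (hclean : ∀ y ∈ Y, RT a T₀ Y y) (h : ContrastAt t L Y q) : t < T₀ := by
  obtain ⟨y, hy, w, hw, y', hy', w', hw', -, -, hne, hne', hd, hd', hc⟩ := h
  obtain ⟨-, -, h3⟩ := hclean y hy
  obtain ⟨-, -, h3'⟩ := hclean y' hy'
  obtain ⟨-, h | h⟩ := h3 w hw hne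
  · obtain ⟨hlow', -⟩ := h3' w' hw' hne'
    nlinarith
  · linarith

/-- GAPCLASH needs margin below the tolerance: `t < T₀` (`47/50 ≤ a ≤ 1`, `T₀ ≤ 1/20`). [this file] -/
theorem margin_lt_of_gapClashAt {a T₀ t L : ℝ} {Y : Set (EuclideanSpace ℝ (Fin 3))} {q : EuclideanSpace ℝ (Fin 3)} (ha : 47 / 50 ≤ a)
    (ha1 : a ≤ 1) (hT₀ : T₀ ≤ 1 / 20) (hclean : ∀ y ∈ Y, RT a T₀ Y y) (h : GapClashAt t L Y q) : t < T₀ := by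
  obtain ⟨y, hy, w, hw, y', hy', w', hw', -, -, hne, hd, hd', hc⟩ := h
  have hne' : w' ≠ y' := by
    intro hwy
    rw [hwy, dist_self] at hd'
    linarith
  obtain ⟨-, -, h3⟩ := hclean y hy
  obtain ⟨-, -, h3'⟩ := hclean y' hy'
  obtain ⟨-, h | h⟩ := h3 w hw hne
  · obtain ⟨-, h' | h'⟩ := h3' w' hw' hne'
    · linarith
    · nlinarith
  · linarith

/-! ## §2  The cut by the clean scale -/

/-- `HasCompressedScale T₀ Y`: `Y` is gapped-twelve clean at a COMPRESSED global scale `a ≤ 189/200` (then every bond is `≤ 51/50·189/200 + T₀`,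
`= 0.9679 < a⋆` at `T₀ = 1/250`). -/
def HasCompressedScale (T₀ : ℝ) (Y : Set (EuclideanSpace ℝ (Fin 3))) : Prop :=
  ∃ a : ℝ, 47 / 50 ≤ a ∧ a ≤ 189 / 200 ∧ ∀ y ∈ Y, RT a T₀ Y y

/-- In the uncompressed clean class (`T₀ ≤ 1/250`) there is no SHORT feature at any margin `t ≥ 0`. [this file] -/
theorem not_shortAt_of_uncompressed {T₀ D t L : ℝ} {Y : Set (EuclideanSpace ℝ (Fin 3))} {q : EuclideanSpace ℝ (Fin 3)} (hT₀ : T₀ ≤ 1 / 250)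
    (hY : CleanClass T₀ D Y) (hnc : ¬ HasCompressedScale T₀ Y) (ht : 0 ≤ t) : ¬ ShortAt t L Y q := by
  intro h
  obtain ⟨-, -, -, -, -, a, ha, ha1, hclean⟩ := hY
  have hgt : 189 / 200 < a := by
    by_contra hle
    exact hnc ⟨a, ha, not_lt.1 hle, hclean⟩
  have := scale_lt_of_shortAt hclean h
  linarith

/-- In the uncompressed clean class (`T₀ ≤ 1/250`) there is no LOWGAP feature at any margin `t ≥ 0`. [this file] -/
theorem not_lowGapAt_of_uncompressed {T₀ D t L : ℝ} {Y : Set (EuclideanSpace ℝ (Fin 3))} {q : EuclideanSpace ℝ (Fin 3)} (hT₀ : T₀ ≤ 1 / 250)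
    (hY : CleanClass T₀ D Y) (hnc : ¬ HasCompressedScale T₀ Y) (ht : 0 ≤ t) : ¬ LowGapAt t L Y q := by
  intro h
  obtain ⟨-, -, -, -, -, a, ha, ha1, hclean⟩ := hY
  have hgt : 189 / 200 < a := by
    by_contra hle
    exact hnc ⟨a, ha, not_lt.1 hle, hclean⟩
  have := scale_lt_of_lowGapAt ha1 (by linarith) hclean h
  linarith

/-- **Elastic typing of the uncompressed branch**: a `(t, L)`-strained texture of the uncompressed clean class (`T₀ ≤ 1/250`) carries, `L`-densely,
features of the ELASTIC types LONG / CONTRAST / GAPCLASH only (at every margin `0 < s < t`). [this file] -/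
theorem elastic_types_of_uncompressed {T₀ D t L : ℝ} {Y : Set (EuclideanSpace ℝ (Fin 3))} (hT₀ : T₀ ≤ 1 / 250) (hY : CleanClass T₀ D Y)
    (hnc : ¬ HasCompressedScale T₀ Y) (hV : ∀ a' : ℝ, 47 / 50 ≤ a' → a' ≤ 1 → ViolatorsL a' t L Y) {s : ℝ} (hs : 0 < s) (hst : s < t) :
    ∀ q ∈ Y, LongAt s L Y q ∨ ContrastAt s L Y q ∨ GapClashAt s L Y q := by
  intro q hq
  have hY' := hY
  obtain ⟨hud, -, -, -, -, a, ha, ha1, hclean⟩ := hY'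
  have hviol : ∀ a' : ℝ, 47 / 50 ≤ a' → a' ≤ 1 → ∃ y ∈ Y, dist y q ≤ L ∧ ¬ RT a' s Y y := by
    intro a' h1 h2
    obtain ⟨y, hy, hyq, hno⟩ := hV a' h1 h2 q hq
    exact ⟨y, hy, hyq, hno s hs hst⟩
  have htyp := types_of_violators hud ha ha1 (by linarith) hs.le hclean hviol
  rcases htyp with h | h | h | h | h
  · exact Or.inl h
  · exact absurd h (not_shortAt_of_uncompressed hT₀ hY hnc hs.le)
  · exact absurd h (not_lowGapAt_of_uncompressed hT₀ hY hnc hs.le)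
  · exact Or.inr (Or.inl h)
  · exact Or.inr (Or.inr h)

/-! ### The pieces -/

/-- **The EOS branch in virial currency `CompressedVirialLaw T₀ D`** (strain-free): a texture of the recurrent clean class with a compressed clean
scale has dilation-strained cubes — its mean virial `S₁₂ − S₆` is positive of volume order (`dilationGain ≥ κ ℓ³`).  UNDECIDED·TRUE-type,
INSTRUMENTABLE (census: `min (s₁₂ − s₆)` per site over periodic clean textures with a clean scale `≤ 189/200`; fcc/hcp floor `+0.47` at shell
`0.967`, adversarial tail needs `+16 %`). -/
def CompressedVirialLaw (T₀ D : ℝ) : Prop :=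
  ∀ Y : Set (EuclideanSpace ℝ (Fin 3)), CleanClass T₀ D Y → HasCompressedScale T₀ Y → ∃ κ : ℝ, 0 < κ ∧ DilationStrainedCubes κ Y

/-- **`CompressedRelax T₀ D`** — RELAX restricted to the compressed clean class (KERNEL-WEAKER). [piece] -/
def CompressedRelax (T₀ D : ℝ) : Prop :=
  ∀ Y : Set (EuclideanSpace ℝ (Fin 3)), CleanClass T₀ D Y → HasCompressedScale T₀ Y → ∀ t : ℝ, 0 < t → ∀ L : ℝ,
    (∀ a' : ℝ, 47 / 50 ≤ a' → a' ≤ 1 → ViolatorsL a' t L Y) → ∃ κ : ℝ, 0 < κ ∧ StrainedCubes κ Y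

/-- **`UncompressedRelax T₀ D`** — RELAX restricted to the uncompressed clean class (KERNEL-WEAKER; strain of elastic types only). [piece] -/
def UncompressedRelax (T₀ D : ℝ) : Prop :=
  ∀ Y : Set (EuclideanSpace ℝ (Fin 3)), CleanClass T₀ D Y → ¬ HasCompressedScale T₀ Y → ∀ t : ℝ, 0 < t → ∀ L : ℝ,
    (∀ a' : ℝ, 47 / 50 ≤ a' → a' ≤ 1 → ViolatorsL a' t L Y) → ∃ κ : ℝ, 0 < κ ∧ StrainedCubes κ Y

/-- **The elastic residual `BalancedLiouvilleLaw T₀ D`**: `ElasticLiouvilleLaw` restricted to the UNCOMPRESSED clean class — a uniformly recurrent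
clean texture with no compressed clean scale, sparse charge, locally optimal and virial-balanced, strained (necessarily of the elastic types), has
strained cubes.  KERNEL-WEAKER than `ElasticLiouvilleLaw`; conjecturally vacuous. [piece] -/
def BalancedLiouvilleLaw (T₀ D : ℝ) : Prop :=
  ∀ Y : Set (EuclideanSpace ℝ (Fin 3)), CleanClass T₀ D Y → ¬ HasCompressedScale T₀ Y → SparseCharge Y → LocallyOptimal Y →
    VirialBalanced Y → ∀ t : ℝ, 0 < t → ∀ L : ℝ, (∀ a' : ℝ, 47 / 50 ≤ a' → a' ≤ 1 → ViolatorsL a' t L Y) →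
      ∃ κ : ℝ, 0 < κ ∧ StrainedCubes κ Y

/-! ### Glue -/

/-- RELAX from the two scale branches (exhaustive case split). [this file] -/
theorem edgeRelaxationLaw_of_scaleSplit {T₀ D : ℝ} (hC : CompressedRelax T₀ D) (hU : UncompressedRelax T₀ D) : EdgeRelaxationLaw T₀ D := by
  intro Y hY t ht L hV
  by_cases h : HasCompressedScale T₀ Y
  · exact hC Y hY h t ht L hV
  · exact hU Y hY h t ht L hV

/-- The compressed branch from the virial law, by the dilation test. [this file] -/
theorem compressedRelax_of_virial {T₀ D : ℝ} (h : CompressedVirialLaw T₀ D) : CompressedRelax T₀ D := by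
  intro Y hY hc t _ L _
  obtain ⟨κ, hκ, hd⟩ := h Y hY hc
  exact ⟨κ, hκ, strainedCubes_of_dilationStrained hd⟩

/-- The uncompressed branch from the charge price, the local test and the elastic residual (dilation test discharged). [this file] -/
theorem uncompressedRelax_of_tests {T₀ D : ℝ} (hA : ChargeDensityRelax T₀ D) (hL : LocalRelaxationTest T₀ D) (hB : BalancedLiouvilleLaw T₀ D) :
    UncompressedRelax T₀ D := by
  intro Y hY hnc t ht L hV
  by_cases hρ : ∃ ρ : ℝ, 0 < ρ ∧ DenseCharge ρ Y
  · obtain ⟨ρ, hρ0, hd⟩ := hρ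
    exact hA Y hY t ht L hV ρ hρ0 hd
  · push Not at hρ
    by_cases hP : ∃ κ : ℝ, 0 < κ ∧ DilationStrainedCubes κ Y
    · obtain ⟨κ, hκ, hd⟩ := hP
      exact ⟨κ, hκ, strainedCubes_of_dilationStrained hd⟩
    · push Not at hP
      by_cases hO : LocallyOptimal Y
      · exact hB Y hY hnc (fun ρ h0 => hρ ρ h0) hO (fun κ hκ => hP κ hκ) t ht L hV
      · exact hL Y hY hO

/-- The residual «ElasticLiouville» from the two scale branches. [this file] -/
theorem elasticLiouvilleLaw_of_scaleSplit {T₀ D : ℝ} (hC : CompressedVirialLaw T₀ D) (hB : BalancedLiouvilleLaw T₀ D) :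
    ElasticLiouvilleLaw T₀ D := by
  intro Y hY hS hO hV t ht L hstr
  by_cases hc : HasCompressedScale T₀ Y
  · obtain ⟨κ, hκ, hd⟩ := hC Y hY hc
    exact ⟨κ, hκ, strainedCubes_of_dilationStrained hd⟩
  · exact hB Y hY hc hS hO hV t ht L hstr

/-! ### Kernel-weaker certificates -/

/-- RELAX implies the compressed branch. [this file] -/
theorem compressedRelax_of_edgeRelaxationLaw {T₀ D : ℝ} (h : EdgeRelaxationLaw T₀ D) : CompressedRelax T₀ D :=
  fun Y hY _ t ht L hV => h Y hY t ht L hV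

/-- RELAX implies the uncompressed branch. [this file] -/
theorem uncompressedRelax_of_edgeRelaxationLaw {T₀ D : ℝ} (h : EdgeRelaxationLaw T₀ D) : UncompressedRelax T₀ D :=
  fun Y hY _ t ht L hV => h Y hY t ht L hV

/-- `ElasticLiouvilleLaw` implies its uncompressed restriction. [this file] -/
theorem balancedLiouvilleLaw_of_elasticLiouvilleLaw {T₀ D : ℝ} (h : ElasticLiouvilleLaw T₀ D) : BalancedLiouvilleLaw T₀ D :=
  fun Y hY _ hS hO hV t ht L hstr => h Y hY hS hO hV t ht L hstr

/-- RELAX implies the elastic residual. [this file] -/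
theorem balancedLiouvilleLaw_of_edgeRelaxationLaw {T₀ D : ℝ} (h : EdgeRelaxationLaw T₀ D) : BalancedLiouvilleLaw T₀ D :=
  balancedLiouvilleLaw_of_elasticLiouvilleLaw (elasticLiouvilleLaw_of_edgeRelaxationLaw h)

/-! ### Cones -/

/-- **RELAX from the shared crux, the local test, the virial law and the elastic residual.** [this file] -/
theorem edgeRelaxationLaw_of_ceg_local_virial_balanced {T₀ D : ℝ} (hCEG : ChargedEnergyGap) (hL : LocalRelaxationTest T₀ D)
    (hC : CompressedVirialLaw T₀ D) (hB : BalancedLiouvilleLaw T₀ D) : EdgeRelaxationLaw T₀ D :=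
  edgeRelaxationLaw_of_scaleSplit (compressedRelax_of_virial hC)
    (uncompressedRelax_of_tests (chargeDensityRelax_of_chargedEnergyGap hCEG) hL hB)

/-- The cone of generation 27 in scale form: `GrossCleanBallsU T₀ 10 → ChargedEnergyGap → LocalRelaxationTest T₀ 10 → CompressedVirialLaw T₀ 10 →
BalancedLiouvilleLaw T₀ 10 → CleanlessExcessT → CoherentResidual 10 → RobustDefectLimitWindows` (`0 < T₀`). [this file] -/
theorem rdef_of_grossU_scaleSplit_coherent {T₀ : ℝ} (hT : 0 < T₀) (hG : GrossCleanBallsU T₀ 10) (hCEG : ChargedEnergyGap)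
    (hL : LocalRelaxationTest T₀ 10) (hC : CompressedVirialLaw T₀ 10) (hB : BalancedLiouvilleLaw T₀ 10) (hCE : CleanlessExcessT)
    (hR : CoherentResidual 10) : RobustDefectLimitWindows :=
  rdef_of_grossU_split_coherent hT hG (chargeDensityRelax_of_chargedEnergyGap hCEG) hL (elasticLiouvilleLaw_of_scaleSplit hC hB) hCE hR

/-- The cone at the record numerals `T₀ = 1/250`. [this file] -/
theorem rdef_of_grossU_scaleSplit_record (hG : GrossCleanBallsU (1 / 250) 10) (hCEG : ChargedEnergyGap)
    (hL : LocalRelaxationTest (1 / 250) 10) (hC : CompressedVirialLaw (1 / 250) 10) (hB : BalancedLiouvilleLaw (1 / 250) 10)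
    (hCE : CleanlessExcessT) (hR : CoherentResidual 10) : RobustDefectLimitWindows :=
  rdef_of_grossU_scaleSplit_coherent (T₀ := 1 / 250) (by norm_num) hG hCEG hL hC hB hCE hR

end Summit.AtomisticToContinuum.Crystallization.Theorems.OverbindingBudgetElasticSplitScale
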